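import Summits.BirchSwinnertonDyer.Rank1Residual.X11b.RelaxationOfSelmerClass
import Summits.BirchSwinnertonDyer.BirchSwinnertonDyer.Theorems.DerivedKatoValuationDoorDerivedKatoDoorStubSandwichFromDA
import Summits.BirchSwinnertonDyer.BirchSwinnertonDyer.Theorems.CongruentShaFreeCutKatoKummerLogTorsion
import Summits.BirchSwinnertonDyer.Rank1Residual.Additive.KatoDescentLocPKummerLogExistence
import Summits.BirchSwinnertonDyer.Rank1Residual.X11b.KummerTorsionDecomposition
import HarnessLib

/-!
# THE KURIHARA–POLLACK LINE FOR INTEGRAL CLASSES, PROVED — «ONE class of `H¹(ℤ[1/p], T_pE)` with a Kummer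
# localisation of non-zero logarithm at `p` makes EVERY class of `H¹(ℤ[1/p], T_pE)` Kummer at `p`»
# (`Kato2004.HasLocPKummerLog`; every `E/ℚ`, EVERY prime `p`) — the existence of Kummer logarithms of cell
# bsd-cm's LOG-EX (`KatoDescentLocPKummerLogExistence.lean`) with the rational point replaced by a GLOBAL CLASS;
# and its consumer: the upper sandwich `(D-A₂ ∧ Loc_p) ⇒ D-K₂` of route `DerivedKatoValuationDoor`
# (stmt-BirchSwinnertonDyer-23024, line `birth`) from the SINGLE named fact `Kato2004.exists_colemanMap_admissibleZeta`
# (seat `bsd-input-dkvd-coleman-zeta`, literature-prover, LADDER-BSD «inputs→unconditional»)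

HONEST FRAMING. Theorems only (no definition, no named fact, no instance, no `sorry`); closes no item;
nothing booked; BSD is NOT proved by any of this and no summit statement is touched. What changes for route
`DerivedKatoValuationDoor`: stub 1b of `Cruxes/DerivedKatoDoor/Lines/birth.lean`
(`stub_hasLocPKummerLogOfExistsLogNeZero` = the Literature named fact
`Kato2004.hasLocPKummerLog_of_exists_log_ne_zero`, Kurihara–Pollack 2007 Lemma 1.4) is NO LONGER NEEDED by
the sandwich: the consumer `Theorems.DerivedKatoValuationDoor.stub_sandwichFromDA_of_facts (hC) (hKP)` applies
`hKP` only to an INTEGRAL witness `x ∈ H¹(ℤ[1/p], T_pW)` (the `Loc_p` clause of D-A₂ carries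
`x ∈ Kato2004.integralH1 … p ⊤`) and to the INTEGRAL bottom layer `h(𝟙) = layerZeroToTop (I.proj 0 h)`
(`layerZeroToTop_mem_integralH1`, `IwasawaH1Data.proj_mem`), and for integral classes the Kurihara–Pollack
line is a THEOREM of the tree's Poitou–Tate engine (this file, §1–§4). Hence `sandwichFromDA_of_colemanMap`
(§5): the registered signature of `stub_sandwichFromDA`, VERBATIM, from `Kato2004.exists_colemanMap_admissibleZeta`
ALONE. The Coleman-map fact itself (Rubin 1998 Prop. A.2 / Cor. 7.2 (ii) = Kato Thm. 16.4 (ii), 16.6,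
Prop. 17.11; size XL: the ordinary Coleman map on the pinned `𝐇¹` and its value law at `𝟙`) is NOT proved
here. §6 records the reduction of the VERBATIM fact `hasLocPKummerLog_of_exists_log_ne_zero` (ALL classes of
`H¹(Γ_ℚ, T_pW)`, not only integral ones) to the one missing input «every class of `H¹(Γ_ℚ, T_pW)` has a
non-zero multiple in `H¹(ℤ[1/p], T_pW)`» (unramified at good `ℓ ≠ p` by Frobenius weights, torsion at bad
`ℓ ≠ p`; Rubin, *Euler Systems*, Lemma 1.3.5 / Cor. B.3.4 — NOT in the tree: it needs the structure of tame
inertia). This file lives in the cell topic `Rank1Residual/Additive` next to the LOG-EX files it extends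
(`Summits/…/Theorems/` is prover-only for a literature-prover seat).

## The mathematics (Kurihara–Pollack 2007, proof of Lemma 1.4 and of Prop. 3.4 (2); Kato (14.9.3) ⊗ ℚ)

Let `x, y ∈ A = H¹(ℤ[1/p], T_pW)` with `loc_p(m x) ≡ κ_k(Q) (mod p^k)` for every `k`, `Q ∈ W(ℚ_p)` of non-zero
logarithm (hence of infinite order). The tree's uniform «Kummer away from `p`» multiple `T` puts
`ξ_k := T • red_{p^k}(m x)` in `H¹_{𝓛, ⊤ at v_p}(ℚ, W[p^k])` for every `k`, with `loc_p ξ_k = κ_k(T • Q)` (§1).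
POITOU–TATE with ONE CLASS (`X11b/RelaxationOfSelmerClass.lean`, fed by the tree THEOREMS
`poitouTate_sum_localTatePairing_eq_zero_holds`, `localEulerPoincareCharacteristic_holds`):
`[H¹_{𝓛, ⊤ at v_p} : Sel^{(p^k)}] ≤ [W(ℚ_p) : ℤ·(T•Q) + p^k W(ℚ_p)] ∣ C` uniformly in `k` (`exists_uniform_index_dvd`),
so ONE `M ≠ 0` has `M • red_{p^k} y ∈ Sel^{(p^k)}(W/ℚ)` for every `k` (§2); then `loc_p(M y)` is levelwise a local
Kummer class and the tower + `p`-adic completeness of `W(ℚ_p)` glue the points (§3 = part 3 of LOG-EX):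
`HasLocPKummerLog W p y t'`. This is «`dim im(H¹(ℚ,V) → H¹(ℚ_p,V)) = 1`, and the line IS `H¹_f` once it meets
`H¹_f` non-trivially» in the tree's finite-level Kummer currency.

* §1 `exists_point_kummerOutside_of_hasLocPKummerLog` (the witness `P₀ = T • Q`, classes `ξ_k`); §2
  `exists_uniform_nsmul_mem_selmerGroup_of_class` (ONE `M ≠ 0`, `M • red_{p^{k+1}} y ∈ Sel` for all `k`); §3
  `exists_hasLocPKummerLog_of_uniform_nsmul_mem_selmerGroup` (gluing); §4
  **`hasLocPKummerLog_of_exists_log_ne_zero_of_mem_integralH1`** (THE LINE, integral classes, every `W`, every `p`);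
  §5 **`sandwichFromDA_of_colemanMap (hC : exists_colemanMap_admissibleZeta)`** (the registered signature of
  `stub_sandwichFromDA` verbatim, from ONE fact); §6
  `hasLocPKummerLog_of_exists_log_ne_zero_of_forall_exists_nsmul_mem_integralH1` (the VERBATIM Literature fact
  from the typed missing input «`∀ y ∈ H¹(Γ_ℚ, T_pW), ∃ m ≠ 0, m • y ∈ H¹(ℤ[1/p], T_pW)`»).

References: [KuriharaPollack2007] §1.4 Lemma 1.4, proof of Prop. 3.4 (2); [Kato2004Asterisque] §8.2, §14.9 (14.9.3);
[JetchevSkinnerWan2017] Prop. 3.2.1; [MilneADT2006] I Thm. 2.8, 4.10 (b), Lemma 6.15; [BlochKato1990] Ex. 3.11;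
[SilvermanAEC2009] IV.6.4, VII.6.3, VIII §2, X §4; [Rubin2000] Lemma 1.3.5, Cor. B.3.4; [Rubin1998Durham] Prop. A.2, Cor. 7.2.
-/

set_option autoImplicit false

noncomputable section

open scoped Classical NumberField ContRepresentation

open CategoryTheory Field IsDedekindDomain NumberField
open Literature.NumberTheory.GaloisRepresentations Literature.NumberTheory.GaloisCohomology
open Literature.NumberTheory.EllipticCurves Literature.NumberTheory.EllipticCurves.Kato2004
open Literature.NumberTheory.EllipticCurves.Kato2004.EulerSystemValues
open Literature.NumberTheory.EllipticCurves.ModularForms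
open Literature.NumberTheory.EllipticCurves.IwasawaAlgebra
open WeierstrassCurve (geomPoints geomTorsion galH1Torsion selmerLocalKer selmerGroup torsionPoints)
open Summit.BirchSwinnertonDyer.Rank1Residual.X11b (KummerDecomp.res_torsionH1OfDvd
  KummerDecomp.map_torsionInclusion_localKummerMap Relaxation.relIndex_selmerGroup_kummerOutside_le_index_zmultiples_of_facts)
open Summit.BirchSwinnertonDyer.BirchSwinnertonDyer.Theorems.CongruentShaFreeCutKatoKummerLogTorsion
  (padicLogLocal_eq_zero_of_isOfFinAddOrder padicLogLocal_eq_padicLog)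
open Summit.BirchSwinnertonDyer.BirchSwinnertonDyer.Theorems.DerivedKatoValuationDoor
  (order_natCast_prime_pow constantCoeff_ne_zero_of_order_eq_zero)

namespace Summit.BirchSwinnertonDyer.Rank1Residual.Additive.LocPKummer

variable (W : WeierstrassCurve ℚ) [W.IsElliptic] (p : ℕ) [Fact p.Prime] [ContinuousSMul ℤ_[p] (W.tateModule p)]

/-! ## §1 The witness: a local point of infinite order whose Kummer classes come from relaxed Selmer classes -/

/-- **From a Kummer localisation of non-zero logarithm to a relaxed-Selmer witness at every level.** For
`x ∈ H¹(ℤ[1/p], T_pW)` with `HasLocPKummerLog W p x t`, `t ≠ 0` (witness `m ≠ 0`, `Q ∈ W(ℚ_p)`, `loc_p(m x) ≡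
κ_k(Q)`, `log_ω Q = m t ≠ 0`): `P₀ = T • Q ∈ W(ℚ_v)` (`T` the tree's uniform «Kummer away from `p`» multiple) has
infinite order (AEC IV.6.4), and for every `k` the class `ξ_k = ι_*(T • red_{p^k}(m x)) ∈ H¹_{𝓛, ⊤ at v_p}(ℚ, W[p^k])`
has `loc_p ξ_k = κ_{p^k}(P₀)` (`res ∘ ι_* = ι_* ∘ res`, `ι_* κ_{(p:ℤ)^k}(P) = κ_{p^k}(P)` between the two level dialects).
[cite: KuriharaPollack2007, proof of Prop. 3.4 (2)] [cite: SilvermanAEC2009, IV.6.4, VIII.§2 and X.§4 diagram (**)] -/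
theorem exists_point_kummerOutside_of_hasLocPKummerLog [W.IsGloballyMinimal] {x : H1 (tateRep W p) ⊤}
    (hx : x ∈ integralH1 (tateRep W p) p ⊤) {t : ℚ_[p]} (ht : t ≠ 0) (hxt : HasLocPKummerLog W p x t) :
    ∃ P₀ : (W.baseChange ((primePlace p).adicCompletion ℚ)).toAffine.Point, ¬ IsOfFinAddOrder P₀ ∧
      ∀ k : ℕ, ∃ ξ : galoisCohomology (W.torsionGaloisModule ((p ^ k : ℕ) : ℤ)) 1,
        ξ ∈ kummerOutside W (p ^ k) {(Sum.inr (primePlace p) : Place ℚ)} ∧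
        galoisCohomology.localization (W.torsionGaloisModule ((p ^ k : ℕ) : ℤ)) (Sum.inr (primePlace p)) 1 ξ =
          W.localKummerMap ((primePlace p).adicCompletion ℚ)
            (Int.natCast_ne_zero.mpr (pow_ne_zero k (Fact.out : p.Prime).ne_zero)) P₀ := by
  have hp : p.Prime := Fact.out
  have hpk : ∀ k : ℕ, ((p : ℤ) ^ k) ≠ 0 := fun k => pow_ne_zero k (Int.natCast_ne_zero.mpr hp.ne_zero)
  obtain ⟨m, Q, hm, hk, hlog⟩ := hxt
  -- `Q` has infinite order (its logarithm is `m t ≠ 0`), hence so has `Q_v` and `T • Q_v`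
  have hQ : ¬ IsOfFinAddOrder Q := fun h => by
    have h0 := padicLogLocal_eq_zero_of_isOfFinAddOrder W p h
    rw [hlog] at h0
    exact (mul_ne_zero (Nat.cast_ne_zero.mpr hm) ht) h0
  set Qv := WeierstrassCurve.Affine.Point.map (padicToAdic p) Q with hQv
  have hQv : ¬ IsOfFinAddOrder Qv := fun h =>
    hQ ((WeierstrassCurve.Affine.Point.map_injective (W' := W) (f := padicToAdic p)).isOfFinAddOrder_iff.mp h)
  -- the uniform multiple for the integral class `m • x`
  have hmx : m • x ∈ integralH1 (tateRep W p) p ⊤ := nsmul_mem hx m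
  obtain ⟨T, hT0, hT⟩ := exists_uniform_nsmul_torsionH1OfDvd_mem_kummerOutside W p hmx
  have hTQv : ¬ IsOfFinAddOrder (T • Qv) := fun h => by
    obtain ⟨n, hn, hnQ⟩ := (isOfFinAddOrder_iff_nsmul_eq_zero).mp h
    exact hQv ((isOfFinAddOrder_iff_nsmul_eq_zero).mpr
      ⟨n * T, Nat.mul_pos hn (Nat.pos_of_ne_zero hT0), by rw [mul_nsmul', hnQ]⟩)
  refine ⟨T • Qv, hTQv, fun k => ⟨_, hT k, ?_⟩⟩
  -- the level-`p^k` reduction of `m • x`, typed in `H¹(ℚ, W[p^k]) = galH1Torsion` (one ambient type for `•`)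
  set c : galH1Torsion W ((p : ℤ) ^ k) :=
    (ofTopSubgroup (W.torsionGaloisModule ((p : ℤ) ^ k)).toTopRep 1).hom (reduceH1Pk W p k ⊤ (m • x)) with hc
  have hck : galoisCohomology.res (W.torsionGaloisModule ((p : ℤ) ^ k)) ((primePlace p).adicCompletion ℚ) 1 c =
      W.localKummerMap ((primePlace p).adicCompletion ℚ) (hpk k) Qv := by
    rw [hc, ← locModPk_apply]
    exact hk k
  -- the localisation of `ι_*(T • c)` read through `res` at `ℚ_v` (definitionally the same map)
  show galoisCohomology.res (W.torsionGaloisModule ((p ^ k : ℕ) : ℤ)) ((primePlace p).adicCompletion ℚ) 1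
      (WeierstrassCurve.torsionH1OfDvd W (intPow_dvd_natCast_pow' p k) (T • c)) = _
  -- `res (T • c) = T • res c`, read across the tree's two names for `H¹(ℚ, W[p^k])` (cf. `KummerDecomp.res_nsmul`)
  have hres : galoisCohomology.res (W.torsionGaloisModule ((p : ℤ) ^ k)) ((primePlace p).adicCompletion ℚ) 1 (T • c) =
      T • galoisCohomology.res (W.torsionGaloisModule ((p : ℤ) ^ k)) ((primePlace p).adicCompletion ℚ) 1 c :=
    map_nsmul (galoisCohomology.res (W.torsionGaloisModule ((p : ℤ) ^ k)) ((primePlace p).adicCompletion ℚ) 1) T c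
  rw [KummerDecomp.res_torsionH1OfDvd, hres, hck,
    ← map_nsmul (W.localKummerMap ((primePlace p).adicCompletion ℚ) (hpk k)) T Qv,
    KummerDecomp.map_torsionInclusion_localKummerMap W ((primePlace p).adicCompletion ℚ)
      (intPow_dvd_natCast_pow' p k) (hpk k)
      (Int.natCast_ne_zero.mpr (pow_ne_zero k hp.ne_zero)) (m := 1) (by rw [one_mul, Nat.cast_pow]),
    one_smul]

/-! ## §2 The uniform Selmer multiple of the reductions of an integral class, from ONE witness class -/

/-- **ONE `M ≠ 0` with `M • red_{p^{k+1}} y ∈ Sel^{(p^{k+1})}(W/ℚ)` for EVERY `k`**, for `y ∈ H¹(ℤ[1/p], T_pW)`, given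
a local point `P₀ ∈ W(ℚ_v)` of infinite order whose level-`p^k` Kummer classes are localisations of relaxed Selmer
classes `ξ_k` (§1). Verbatim the tree's `exists_uniform_nsmul_mem_selmerGroup` (rational point) with the Poitou–Tate
bound in its one-class form `X11b.Relaxation.relIndex_selmerGroup_kummerOutside_le_index_zmultiples_of_facts`:
`[H¹_{𝓛,⊤ at v_p}(ℚ,W[n]) : Sel⁽ⁿ⁾] ≤ [W(ℚ_p) : ℤ·P₀ + nW(ℚ_p)] ∣ C` (`exists_uniform_index_dvd`), `M = C!·T_y`.
[cite: KuriharaPollack2007, §1.4 Lemma 1.4] [cite: Kato2004Asterisque, §14.9 (14.9.3) (p. 240)]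
[cite: JetchevSkinnerWan2017, Prop. 3.2.1 (proof, arXiv:1512.06894 pp. 10–11)] -/
theorem exists_uniform_nsmul_mem_selmerGroup_of_class [W.IsGloballyMinimal] {y : H1 (tateRep W p) ⊤}
    (hy : y ∈ integralH1 (tateRep W p) p ⊤)
    {P₀ : (W.baseChange ((primePlace p).adicCompletion ℚ)).toAffine.Point} (hP₀ : ¬ IsOfFinAddOrder P₀)
    (hξ : ∀ k : ℕ, ∃ ξ : galoisCohomology (W.torsionGaloisModule ((p ^ k : ℕ) : ℤ)) 1,
        ξ ∈ kummerOutside W (p ^ k) {(Sum.inr (primePlace p) : Place ℚ)} ∧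
        galoisCohomology.localization (W.torsionGaloisModule ((p ^ k : ℕ) : ℤ)) (Sum.inr (primePlace p)) 1 ξ =
          W.localKummerMap ((primePlace p).adicCompletion ℚ)
            (Int.natCast_ne_zero.mpr (pow_ne_zero k (Fact.out : p.Prime).ne_zero)) P₀) :
    ∃ M : ℕ, M ≠ 0 ∧ ∀ k : ℕ,
      M • (ofTopSubgroup (W.torsionGaloisModule ((p : ℤ) ^ (k + 1))).toTopRep 1).hom (reduceH1Pk W p (k + 1) ⊤ y) ∈
        selmerGroup W ((p : ℤ) ^ (k + 1)) := by
  have hp : p.Prime := Fact.out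
  -- part 2 of the tree: `T • red y` is Kummer away from `p`
  obtain ⟨T, hT0, hT⟩ := exists_uniform_nsmul_torsionH1OfDvd_mem_kummerOutside W p hy
  -- part 1 of the tree: the uniform index bound at `P₀`
  obtain ⟨C, hC0, hC⟩ := exists_uniform_index_dvd W p hP₀
  refine ⟨C.factorial * T, Nat.mul_ne_zero (Nat.factorial_ne_zero C) hT0, fun k => ?_⟩
  haveI : NeZero (p ^ (k + 1)) := ⟨pow_ne_zero _ hp.ne_zero⟩
  set c : galH1Torsion W ((p : ℤ) ^ (k + 1)) :=
    (ofTopSubgroup (W.torsionGaloisModule ((p : ℤ) ^ (k + 1))).toTopRep 1).hom (reduceH1Pk W p (k + 1) ⊤ y) with hc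
  have hc' : WeierstrassCurve.torsionH1OfDvd W (intPow_dvd_natCast_pow' p (k + 1)) (T • c) ∈
      kummerOutside W (p ^ (k + 1)) {(Sum.inr (primePlace p) : Place ℚ)} := hT (k + 1)
  -- the relative index `r = [KO : Sel]` is non-zero and `≤ C` (one-class relaxation bound at `ξ_{k+1}`)
  have hr0 := relIndex_selmerGroup_kummerOutside_ne_zero W (p ^ (k + 1)) (primePlace p)
  obtain ⟨ξ, hξKO, hξloc⟩ := hξ (k + 1)
  have hidx : (AddSubgroup.zmultiples P₀ ⊔
      (zsmulAddGroupHom ((p ^ (k + 1) : ℕ) : ℤ) :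
        (W.baseChange ((primePlace p).adicCompletion ℚ)).toAffine.Point →+ _).range).index ∣ C := by
    refine (AddSubgroup.index_dvd_of_le (sup_le_sup le_rfl (le_of_eq ?_))).trans (hC (k + 1))
    rw [Nat.cast_pow]
  have hrle : (selmerGroup W ((p ^ (k + 1) : ℕ) : ℤ)).relIndex
      (kummerOutside W (p ^ (k + 1)) {(Sum.inr (primePlace p) : Place ℚ)}) ≤ C :=
    (Relaxation.relIndex_selmerGroup_kummerOutside_le_index_zmultiples_of_facts W (p ^ (k + 1)) (primePlace p)
      (hp.isPrimePow.pow (Nat.succ_ne_zero k)) (poitouTate_sum_localTatePairing_eq_zero_holds ℚ)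
      (@localEulerPoincareCharacteristic_holds _ _ _ _ _ (charZero_adicCompletion _)) hξKO P₀ hξloc).trans
      (Nat.le_of_dvd (Nat.pos_of_ne_zero hC0) hidx)
  -- `C! •` a class of `KO` is Selmer
  obtain ⟨q, hq⟩ := Nat.dvd_factorial (Nat.pos_of_ne_zero hr0) hrle
  have hmem : C.factorial • WeierstrassCurve.torsionH1OfDvd W (intPow_dvd_natCast_pow' p (k + 1)) (T • c) ∈
      selmerGroup W ((p ^ (k + 1) : ℕ) : ℤ) := by
    rw [hq, mul_nsmul]
    exact AddSubgroup.nsmul_mem _ ((selmerGroup W ((p ^ (k + 1) : ℕ) : ℤ)).nsmul_relIndex_mem hc') q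
  have key : WeierstrassCurve.torsionH1OfDvd W (intPow_dvd_natCast_pow' p (k + 1)) ((C.factorial * T) • c) ∈
      selmerGroup W ((p ^ (k + 1) : ℕ) : ℤ) := by
    rw [mul_nsmul', map_nsmul]
    exact hmem
  exact (torsionH1OfDvd_mem_selmerGroup_iff W _ _).mp key

/-! ## §3 Gluing: from a uniform Selmer multiple to a Kummer logarithm -/

/-- **From a uniform Selmer multiple to the Kummer logarithm** (part 3 of cell bsd-cm's LOG-EX proof, with the
uniform Selmer multiple as hypothesis instead of a rational point): `loc_p(M y)` is levelwise a local Kummer class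
`κ_k(Q_k)` (`exists_localKummerMap_eq_locModPk`), the tower gives `Q_{k+1} ≡ Q_k (mod p^k W(ℚ_v))`, `p`-adic
completeness glues them to ONE `Q` up to the torsion exponent `t` (`exists_glue_adicCompletion`): `log = log_ω(t•Q)/(tM)`.
[cite: Kato2004Asterisque, §14.9 (14.9.3) (p. 240) and §14.1 (p. 235)] [cite: BlochKato1990, Def. 3.10 and Ex. 3.11]
[cite: SilvermanAEC2009, IV.6.4 and VII.6.3] -/
theorem exists_hasLocPKummerLog_of_uniform_nsmul_mem_selmerGroup [W.IsGloballyMinimal] {y : H1 (tateRep W p) ⊤}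
    (hM : ∃ M : ℕ, M ≠ 0 ∧ ∀ k : ℕ,
      M • (ofTopSubgroup (W.torsionGaloisModule ((p : ℤ) ^ (k + 1))).toTopRep 1).hom (reduceH1Pk W p (k + 1) ⊤ y) ∈
        selmerGroup W ((p : ℤ) ^ (k + 1))) :
    ∃ t : ℚ_[p], HasLocPKummerLog W p y t := by
  have hp : p.Prime := Fact.out
  have hpk : ∀ k : ℕ, ((p : ℤ) ^ k) ≠ 0 := fun k => pow_ne_zero k (Int.natCast_ne_zero.mpr hp.ne_zero)
  obtain ⟨M, hM0, hM⟩ := hM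
  -- levelwise Kummer points at the levels `p^{k+1}`
  choose Q hQ using fun k => exists_localKummerMap_eq_locModPk W p (k + 1) M y (hM k)
  -- the transition maps and the tower: the same points work at level `p^k`
  choose F hF using fun k => exists_transition W p k
  have hQk : ∀ k, W.localKummerMap ((primePlace p).adicCompletion ℚ) (hpk k) (Q k) =
      locModPk W p k (M • y) := fun k => by
    rw [← map_restrictField_localKummerMap_succ W p k (F k) (hF k) (Q k), hQ k,
      map_restrictField_locModPk_succ W p k (F k) (hF k)]
  -- compatibility `Q (k+1) - Q k ∈ p^k W(ℚ_v)` (indeed `∈ p^{k+1} W(ℚ_v) = ker κ_{k+1}`)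
  have hcompat : ∀ k, Q (k + 1) - Q k ∈
      (zsmulAddGroupHom ((p : ℤ) ^ k) : (W.baseChange ((primePlace p).adicCompletion ℚ)).toAffine.Point →+ _).range := by
    intro k
    have h1 : Q (k + 1) - Q k ∈ (W.localKummerMap ((primePlace p).adicCompletion ℚ) (hpk (k + 1))).ker := by
      rw [AddMonoidHom.mem_ker, map_sub, hQ k, hQk (k + 1), sub_self]
    rw [@WeierstrassCurve.ker_localKummerMap ℚ _ W _ _ _ _ _ _ (charZero_adicCompletion _) (hpk (k + 1))] at h1
    obtain ⟨R, hR⟩ := h1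
    refine ⟨(p : ℤ) • R, ?_⟩
    rw [zsmulAddGroupHom_apply, ← hR, zsmulAddGroupHom_apply, smul_smul, ← pow_succ]
  -- glue the compatible sequence to ONE point, up to the torsion exponent `t`
  obtain ⟨t, Qinf, ht0, hglue⟩ := exists_glue_adicCompletion W p Q hcompat
  have hQinf : ∀ k, W.localKummerMap ((primePlace p).adicCompletion ℚ) (hpk k) ((t : ℤ) • Qinf) =
      locModPk W p k ((t * M) • y) := by
    intro k
    have h1 : W.localKummerMap ((primePlace p).adicCompletion ℚ) (hpk k) ((t : ℤ) • Qinf - (t : ℤ) • Q k) = 0 := by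
      rw [← zsmul_sub, ← AddMonoidHom.mem_ker,
        @WeierstrassCurve.ker_localKummerMap ℚ _ W _ _ _ _ _ _ (charZero_adicCompletion _) (hpk k)]
      exact hglue k
    rw [map_sub, sub_eq_zero] at h1
    rw [h1, map_zsmul, hQk k, natCast_zsmul, ← map_nsmul, ← mul_nsmul']
  -- read `t • Qinf` in `W(ℚ_p)` and take `t_log = log_ω(t • Qinf) / (t M)`
  obtain ⟨Q', hQ'⟩ := ContraCount.exists_map_padicToAdic_eq W p ((t : ℤ) • Qinf)
  have hne : ((t * M : ℕ) : ℚ_[p]) ≠ 0 := Nat.cast_ne_zero.mpr (Nat.mul_ne_zero ht0 hM0)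
  refine ⟨padicLogLocal W p Q' / ((t * M : ℕ) : ℚ_[p]), ?_⟩
  unfold HasLocPKummerLog
  refine ⟨t * M, Q', Nat.mul_ne_zero ht0 hM0, fun k => ?_, (mul_div_cancel₀ _ hne).symm⟩
  rw [hQ', hQinf k]

/-! ## §4 The Kurihara–Pollack line for integral classes -/

/-- **THE KURIHARA–POLLACK LINE FOR INTEGRAL CLASSES (Kurihara–Pollack 2007, Lemma 1.4 with the proof of
Prop. 3.4 (2); Kato (14.9.3) ⊗ ℚ; Bloch–Kato Ex. 3.11), PROVED for every `W/ℚ` (globally minimal model) and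
EVERY prime `p`.** If ONE class `x ∈ H¹(ℤ[1/p], T_pW)` (`Kato2004.integralH1 (tateRep W p) p ⊤`) localises at `p`
to a Kummer class of NON-ZERO logarithm (`HasLocPKummerLog W p x t`, `t ≠ 0`), then EVERY `y ∈ H¹(ℤ[1/p], T_pW)`
localises at `p` to a Kummer class (`loc_p(m·y) = κ(Q)` at every level `p^k`, some `m ≠ 0`, `Q ∈ W(ℚ_p)`): the
image of `H¹(ℤ[1/p], T_pW)` in `H¹(ℚ_p, W[p^k])` is isotropic (Poitou–Tate), hence inside the annihilator of the
line `ℤ·κ_k(P₀)` it contains, whose index over `κ_k(W(ℚ_p))` is bounded uniformly in `k` — §1–§3. The integral-class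
case of the Literature named fact `Kato2004.hasLocPKummerLog_of_exists_log_ne_zero`, and the only case its consumer
`stub_sandwichFromDA_of_facts` uses. [cite: KuriharaPollack2007, §1.4 Lemma 1.4 and proof of Prop. 3.4 (2)]
[cite: Kato2004Asterisque, §14.9 (14.9.3) (p. 240)] [cite: BlochKato1990, Prop. 3.8 and Ex. 3.11]
[cite: MilneADT2006, Ch. I, Thm. 4.10(b) and Thm. 2.8] -/
theorem hasLocPKummerLog_of_exists_log_ne_zero_of_mem_integralH1 [W.IsGloballyMinimal]
    (hx : ∃ (x : H1 (tateRep W p) ⊤) (t : ℚ_[p]),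
      x ∈ integralH1 (tateRep W p) p ⊤ ∧ t ≠ 0 ∧ HasLocPKummerLog W p x t)
    {y : H1 (tateRep W p) ⊤} (hy : y ∈ integralH1 (tateRep W p) p ⊤) :
    ∃ t' : ℚ_[p], HasLocPKummerLog W p y t' := by
  obtain ⟨x, t, hxA, ht, hxt⟩ := hx
  obtain ⟨P₀, hP₀, hξ⟩ := exists_point_kummerOutside_of_hasLocPKummerLog W p hxA ht hxt
  exact exists_hasLocPKummerLog_of_uniform_nsmul_mem_selmerGroup W p
    (exists_uniform_nsmul_mem_selmerGroup_of_class W p hy hP₀ hξ)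

/-! ## §5 The upper sandwich from the Coleman-map fact ALONE -/

omit [ContinuousSMul ℤ_[p] (W.tateModule p)] in
/-- **Stub `stub_sandwichFromDA` of line `birth` (crux `DerivedKatoDoor`, stmt-BirchSwinnertonDyer-23024) from the
SINGLE Literature named fact `Kato2004.exists_colemanMap_admissibleZeta`** (Rubin 1998 Prop. A.2 / Cor. 7.2 (ii)
= Kato Thm. 16.4 (ii), 16.6 (2), Prop. 17.11: the ordinary Coleman map `L = Col ∘ loc_p` on the pinned `𝐇¹`,
`ord_T L(z₀) = ρ_p` for admissible `z₀`, `L(h)(𝟙) = 0` when `h(𝟙)` is Kummer at `p`). The conclusion is the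
REGISTERED r1/r2 signature of `stub_sandwichFromDA` VERBATIM (= the conclusion of the tree's
`stub_sandwichFromDA_of_facts (hC) (hKP)`): at a door prime, `ρ_p ≤ 2` for every newform of `W` together with
`Loc_p` (an INTEGRAL global class of non-zero Kummer logarithm at `p`) force `v_T(z₀) ≤ 1` for every admissible
Kato zeta class `z₀`. The hypothesis `hKP : hasLocPKummerLog_of_exists_log_ne_zero` of the tree's reduction is
DISCHARGED by §4: the `Loc_p` witness is integral and so is the bottom layer `h(𝟙) = layerZeroToTop (I.proj 0 h)`
(`IwasawaH1Data.proj_mem`, `layerZeroToTop_mem_integralH1`). Proof otherwise verbatim the tree's (`p^m • z₀ =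
T² • h` ⟹ `ρ_p = 2 + ord_T L(h) ≤ 2` ⟹ `L(h)(𝟙) ≠ 0`, against `L(h)(𝟙) = 0`). CONDITIONAL on the one named
fact (unproved, D-0014, size XL); BSD is not proved by any of this.
[cite: Rubin1998Durham, Thm. 6.1, Thm. 7.1, Cor. 7.2 (ii), Prop. A.2]
[cite: Kato2004Asterisque, Thm. 16.4 (ii) (p. 270), Thm. 16.6 (p. 271), Prop. 17.11 (p. 277)]
[cite: KuriharaPollack2007, §1.4 Lemma 1.4] [cite: BlochKato1990, Prop. 3.8 and Ex. 3.11] -/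
theorem sandwichFromDA_of_colemanMap (hC : exists_colemanMap_admissibleZeta) :
    ∀ (W : WeierstrassCurve ℚ) [W.IsElliptic] [W.IsGloballyMinimal] (p : ℕ) [Fact p.Prime]
      [ContinuousSMul ℤ_[p] (W.tateModule p)],
      (5 ≤ p ∧ Literature.NumberTheory.EllipticCurves.IsOrdinaryAt W p ∧ W.HasSurjectiveModNGaloisRep p) →
      ((∀ {N : ℕ} [NeZero N] (f : CuspForm (CongruenceSubgroup.Gamma0 N) 2),
          Literature.NumberTheory.EllipticCurves.ModularForms.IsNewformOf W f →
            (Literature.NumberTheory.EllipticCurves.padicLFunction f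
              (Literature.NumberTheory.EllipticCurves.unitRoot W p : ℚ_[p])).order ≤ 2) ∧
        (∃ (x : Literature.NumberTheory.GaloisRepresentations.H1
            (Literature.NumberTheory.EllipticCurves.Kato2004.EulerSystemValues.tateRep W p) ⊤) (t : ℚ_[p]),
          x ∈ Literature.NumberTheory.EllipticCurves.Kato2004.integralH1
              (Literature.NumberTheory.EllipticCurves.Kato2004.EulerSystemValues.tateRep W p) p ⊤ ∧
            t ≠ 0 ∧ Literature.NumberTheory.EllipticCurves.Kato2004.HasLocPKummerLog W p x t)) →
      ∀ (K : Literature.NumberTheory.EllipticCurves.ZpExtension ℚ p) (hK : K.IsCyclotomic)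
        (γ : Field.absoluteGaloisGroup ℚ)
        (I : Literature.NumberTheory.EllipticCurves.Kato2004.IwasawaH1Data W p K γ) (z₀ : I.H),
        K.IsTopGenerator γ →
        Literature.NumberTheory.EllipticCurves.Kato2004.IsAdmissibleZetaClass W p K hK I z₀ →
          ¬ ∃ (h : I.H) (m : ℕ),
            ((p : Literature.NumberTheory.EllipticCurves.IwasawaAlgebra p) ^ m) • z₀ =
              ((PowerSeries.X : Literature.NumberTheory.EllipticCurves.IwasawaAlgebra p) ^ 2) • h := by
  intro W _ _ p _ _ hdoor hDA K hK γ I z₀ hγ hz hdiv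
  obtain ⟨h, m, hhm⟩ := hdiv
  obtain ⟨h5, hord, hsurj⟩ := hdoor
  obtain ⟨hcap, hLoc⟩ := hDA
  -- the newform carried by the admissible class (first witnesses of `IsAdmissibleZetaClass`)
  have hz' := hz
  obtain ⟨-, N, hN, f, hf, -⟩ := hz'
  -- (C1): the Coleman map `L = Col ∘ loc_p` on the pinned `𝐇¹`
  obtain ⟨L, hLord, hLval⟩ := hC W p h5 hord hsurj f hf K hK γ hγ I
  -- (C2) with D-A₂: `ord_T L(z₀) = ρ_p ≤ 2`
  have hρ : (L z₀).order ≤ 2 := (hLord z₀ hz).le.trans (hcap f hf)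
  -- apply `L` to `p^m • z₀ = T² • h`
  have hrel : ((p : IwasawaAlgebra p) ^ m) * L z₀ = (PowerSeries.X : IwasawaAlgebra p) ^ 2 * L h := by
    have e := congrArg L hhm
    simpa only [map_smul, smul_eq_mul] using e
  -- orders in the domain `ℤ_p⟦T⟧`: `0 + ord_T L(z₀) = 2 + ord_T L(h)`
  have hordeq : (L z₀).order = 2 + (L h).order := by
    have e := congrArg PowerSeries.order hrel
    rwa [PowerSeries.order_mul, PowerSeries.order_mul, order_natCast_prime_pow, zero_add,
      PowerSeries.order_X_pow] at e
  have hLh : (L h).order = 0 := by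
    have h2 : (2 : ℕ∞) + (L h).order ≤ 2 + 0 := by rw [add_zero, ← hordeq]; exact hρ
    exact nonpos_iff_eq_zero.mp ((ENat.add_le_add_iff_left (by decide)).mp h2)
  -- §4 (the Kurihara–Pollack line for INTEGRAL classes) with `Loc_p`: the bottom layer of `h` is integral
  -- (`proj_mem`, `layerZeroToTop_mem_integralH1`) hence Kummer at `p`; then (C3): `L(h)(𝟙) = 0`
  have hkum : ∃ t' : ℚ_[p], HasLocPKummerLog W p (layerZeroToTop W p K (I.proj 0 h)) t' :=
    hasLocPKummerLog_of_exists_log_ne_zero_of_mem_integralH1 W p hLoc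
      (layerZeroToTop_mem_integralH1 W p K (I.proj_mem 0 h))
  exact constantCoeff_ne_zero_of_order_eq_zero hLh (hLval h hkum)

/-! ## §6 The verbatim Literature fact from the one missing input (integrality up to a multiple) -/

omit [ContinuousSMul ℤ_[p] (W.tateModule p)] in
/-- `log_ω(m • Q) = m · log_ω(Q)` on `W(ℚ_p)` (`padicLogLocal` IS the additive `LocalLog.padicLog`). [cite: SilvermanAEC2009, IV.6.4 and VII.6.3] -/
theorem padicLogLocal_nsmul [W.IsGloballyMinimal] (m : ℕ) (Q : (W.baseChange ℚ_[p]).toAffine.Point) :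
    padicLogLocal W p (m • Q) = (m : ℚ_[p]) * padicLogLocal W p Q := by
  rw [padicLogLocal_eq_padicLog, padicLogLocal_eq_padicLog, map_nsmul, nsmul_eq_mul]

/-- `HasLocPKummerLog` under multiples: the witness `(m₀, Q)` of `x` gives `(m₀, m • Q)` for `m • x`. [cite: BlochKato1990, Ex. 3.11] -/
theorem hasLocPKummerLog_nsmul [W.IsGloballyMinimal] {x : H1 (tateRep W p) ⊤} {t : ℚ_[p]}
    (h : HasLocPKummerLog W p x t) (m : ℕ) : HasLocPKummerLog W p (m • x) ((m : ℚ_[p]) * t) := by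
  obtain ⟨m₀, Q, hm₀, hk, hlog⟩ := h
  refine ⟨m₀, m • Q, hm₀, fun k => ?_, ?_⟩
  · rw [smul_comm, map_nsmul, hk k, ← map_nsmul, ← map_nsmul]
  · rw [padicLogLocal_nsmul, hlog]; ring

/-- `HasLocPKummerLog` descends from a non-zero multiple: `(m₁, Q)` for `m • y` is `(m₁ m, Q)` for `y`. [cite: BlochKato1990, Ex. 3.11] -/
theorem hasLocPKummerLog_of_nsmul [W.IsGloballyMinimal] {y : H1 (tateRep W p) ⊤} {m : ℕ} (hm : m ≠ 0)
    {t : ℚ_[p]} (h : HasLocPKummerLog W p (m • y) t) : HasLocPKummerLog W p y (t / (m : ℚ_[p])) := by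
  obtain ⟨m₁, Q, hm₁, hk, hlog⟩ := h
  have hmQ : (m : ℚ_[p]) ≠ 0 := Nat.cast_ne_zero.mpr hm
  refine ⟨m₁ * m, Q, Nat.mul_ne_zero hm₁ hm, fun k => ?_, ?_⟩
  · rw [mul_nsmul', ← hk k, smul_comm]
  · rw [hlog, Nat.cast_mul, mul_assoc, mul_div_cancel₀ _ hmQ]

omit W p in
/-- **The VERBATIM Literature fact `Kato2004.hasLocPKummerLog_of_exists_log_ne_zero` (Kurihara–Pollack 2007
Lemma 1.4 in Kummer currency, ALL classes of `H¹(Γ_ℚ, T_pW)`) from the ONE missing input**, typed inline: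
«every class `y ∈ H¹(Γ_ℚ, T_pW)` has a non-zero multiple in `H¹(ℤ[1/p], T_pW) = Kato2004.integralH1 … p ⊤`»
(TRUE by print — at a good `ℓ ≠ p` the restriction to inertia of ANY class vanishes, `Hom(I_ℓ, T)^{Frob} =
T(−1)^{Frob_ℓ = 1} = 0` by the Weil bound `a_ℓ ≠ ℓ + 1`; at the finitely many bad `ℓ ≠ p`, `H¹(ℚ_ℓ, T_pE)`
is finite since `H¹(ℚ_ℓ, V_pE) = 0` (local Euler characteristic, `V^{G_ℓ} = 0`) — Rubin, *Euler Systems*,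
Lemma 1.3.5 (ii)–(iii) and Cor. B.3.4; NOT in the tree: it needs the structure of tame inertia). Given it,
§4 applies to `m • x` (logarithm `m t ≠ 0`, `hasLocPKummerLog_nsmul`) and `m' • y`, and the conclusion
descends to `y` (`hasLocPKummerLog_of_nsmul`). [cite: KuriharaPollack2007, §1.4 Lemma 1.4 and proof of Prop. 3.4 (2)]
[cite: Rubin2000, Lemma 1.3.5 and App. B Cor. B.3.4] -/
theorem hasLocPKummerLog_of_exists_log_ne_zero_of_forall_exists_nsmul_mem_integralH1
    (hint : ∀ (W : WeierstrassCurve ℚ) [W.IsElliptic] (p : ℕ) [Fact p.Prime]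
      [ContinuousSMul ℤ_[p] (W.tateModule p)] (y : H1 (tateRep W p) ⊤),
      ∃ m : ℕ, m ≠ 0 ∧ m • y ∈ integralH1 (tateRep W p) p ⊤) :
    hasLocPKummerLog_of_exists_log_ne_zero := by
  intro W _ _ p _ _ hx y
  obtain ⟨x, t, ht, hxt⟩ := hx
  obtain ⟨m, hm, hmx⟩ := hint W p x
  obtain ⟨m', hm', hmy⟩ := hint W p y
  have hx' : ∃ (x' : H1 (tateRep W p) ⊤) (t' : ℚ_[p]),
      x' ∈ integralH1 (tateRep W p) p ⊤ ∧ t' ≠ 0 ∧ HasLocPKummerLog W p x' t' :=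
    ⟨m • x, (m : ℚ_[p]) * t, hmx, mul_ne_zero (Nat.cast_ne_zero.mpr hm) ht, hasLocPKummerLog_nsmul W p hxt m⟩
  obtain ⟨t', ht'⟩ := hasLocPKummerLog_of_exists_log_ne_zero_of_mem_integralH1 W p hx' hmy
  exact ⟨_, hasLocPKummerLog_of_nsmul W p hm' ht'⟩

end Summit.BirchSwinnertonDyer.Rank1Residual.Additive.LocPKummer

end
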